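import Summits.QuantumFields.YangMills.Theorems.UnitScaleTiltProp7LandauCombDict
import Summits.QuantumFields.YangMills.Theorems.UnitScaleTiltProp7HessOnPrintSlice
import Summits.QuantumFields.YangMills.Theorems.UnitScaleTiltProp7LaplaceAFlatLetters
import HarnessLib

/-!
# Route `UnitScaleTilt`, crux K1 «MinimiserStabilityRegPr» (stmt-QuantumFields-19200), route-R E′ architecture (A′) «HCOW-VIA-Σ», package P-A4 — FILE F3
# «MEMBER READING» (the P-A4 pen-of-record's knit door): THE CRUDE SLICE ON PRINT'S SLICE AT A CURVED BACKGROUND, FROM THE COMB BERNSTEIN ROW —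
# `IsLandauPrint W X` ∧ [COMB BERNSTEIN ROW at `W`] ⟹ `‖D*_W X̃‖² ≤ C_P·‖X̃‖²` (`DIV ≤ δ₁ℓ⁻²M`, `ζ = 0`, `δ₁ = C_P`)

Cell `ym3-torus`, width seat `ym3-torus-px12` (gen 5), P-A4 pen of record (★p1 g17 WORD 15; pens V1∕F1 px19 g5, F2 px11 g5, F3 px12 g5 — bus 02:39:52Z).  WHY.  The
elementary curved route (px19 g5 LOCATE e2f41ebf ∕ px11 g5 LOCATE 9e0b8d73: energy minimality of the `ker R` class + a bump×comb-transport competitor) proves a BERNSTEIN ROW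
for every gauge parameter `f` on print's COMB slice — «`Δ^η_W f = Q′_k(W)ᵀμ` (lit `IsLandau138`'s multiplier form, top level) ⟹ `Σ_b |D^η_{W} f(b)|² ≤ C_P·Σ_x |f(x)|²`» (F1-inst's
conclusion, px19).  This file is the DOOR that turns that row, DISPLAYED as the hypothesis `hF1` in exactly the torus letters announced on the bus (02:41:26Z F1-TARGET SHAPE), into the
member statement the (A′) knit consumes: for a route field `X` in the projected Landau gauge `IsLandauPrint W X` (✓ `Prop7SPrint.IsLandauPrint` = lit `IsLandau138` on the based
periodic pullbacks), `‖DstarL2 W (toL2 X)‖² ≤ C_P·‖toL2 X‖²`.  Steps: (§1) the pullback dictionary for the divergence of a one-form and the site Laplacian (companions of w1's ✓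
`Prop7SPrintIn19.covLap_pull`, lit ✓ `covDeriv_pull`); (§2) `IsLandauPrint` read on the torus = the slice hypothesis of `hF1` at `f := D^{η*}_W(η⁻¹X)`; (§3) real scalings
`D^η(c•f) = c•D^η f`, `D^{η*}(c•X) = c•D^{η*}X`; (§4) the member's norms through ✓ `Prop7LandauDict` + px6's ✓ `norm_sq_toL2`∕`norm_sq_toL2S`, closed by ★p1's ✓
`norm_sq_dstar_le_of_bernstein_at` (one Cauchy–Schwarz).  THEOREMS ONLY (0 `def`, 0 `sorry`); `--supports stmt-QuantumFields-19200`, count-neutral.  YM₃ on T³ is a ladder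
rung (R3), not the Clay problem; nothing here claims the comb Bernstein row, `bern_P`, hcoW, (A′), E′, a stub, the crux, d = 4 or the mass gap — the row is DISPLAYED until F1∕F2 land.

WHAT IS PROVED (ns `…Theorems.Prop7DivSqOfCombBernsteinRow`).
* §1 `covLap_pull_site` (pullback dictionary; `covDivB_pull`, `DstarL2_toL2_eq` are ✓ `Prop7LandauCombDict`'s, imported); §2 ★ `isLandauPrint_torus`; §3 `covDerivFwdT_smul_real`, `covDerivT_smul_real`, `covDivFormT_smul_real`;
* §4 ★★ `norm_sq_DL2_toL2S` (member norm on functions);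
* §6 ★★★ `div_sq_le_of_competitorRow` — the same from px19's COMPETITOR ROW directly (energy comparison folded in via ★w1 g14's ✓ `Prop7LandauCombDict`).
* §5 ★★★ `div_sq_le_of_combBernsteinRow (U₀) (hC : 0 ≤ C) (hF1 : COMB BERNSTEIN ROW at U₀) (X) (hX : IsLandauPrint F n K U₀ X) : ‖DstarL2 F n K c₀ U₀ (toL2 F K c₀ X)‖² ≤ C·‖toL2 F K c₀ X‖²`.
HONEST SCOPE.  Bookkeeping (pullbacks, scalings, norms) + one Cauchy–Schwarz; the analytic content (the competitor's energy, the defect rows at `RegPr`) is px19's F1 and px11's F2.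

References: T. Bałaban, CMP 99 (1985) 389–434 [Balaban1985BackgroundPropagators] ((3.3) p.391, (3.8) p.392, (3.21)–(3.23) p.394, (3.42) p.398); CMP 99 (1985) 75–102
[Balaban1985RegularSpaces] ((1.1)–(1.2) p.76, (1.38) p.82); CMP 102 (1985) 277–309 [Balaban1985Variational] ((21) p.281, Prop. 7 p.299).
-/

set_option autoImplicit false

noncomputable section

open scoped Matrix.Norms.L2Operator InnerProductSpace

namespace Summit.QuantumFields.YangMills.Theorems.Prop7DivSqOfCombBernsteinRow

open NormedSpace
open Literature.MathematicalPhysics.QuantumFieldTheory.Balaban1983to89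
open Literature.MathematicalPhysics.QuantumFieldTheory.Balaban1983to89.T3ContinuumYM3Torus
open B7Prop1Explicit renaming Site → LSite
open B7Eq78Linearization (conjR conjR_smul_real)
open B8Ineq132 (covDerivFwd covDeriv)
open B8Eq138LandauZd (covLap covDivB IsLandau138 QT)
open B8Thm4TorusAt (torusLam)
open B9Eq311L2Pairing (WL2)
open B11Eq103H1Complex (SiteL2K BondL2K)
open B10Eq27TorusAxialLog (transl pull pull_apply unitsField toUField)
open B10Eq68TorusRegularity (covDerivT covDeriv_pull)
open T3SectALandauChart (covDerivFwdT formComp covDivFormT eta eta_pos bgUnits)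
open Summit.QuantumFields.YangMills.Theorems.Prop7SPrintIn19 (covDerivFwd_pull)
open Summit.QuantumFields.YangMills.Theorems.Prop7SPrint (IsLandauPrint basePt)
open Summit.QuantumFields.YangMills.Theorems.Prop7SectET3Transport (periodsT3 siteEquiv bondEquiv bgOfCfg)
open Summit.QuantumFields.YangMills.Theorems.Prop7SectET3HilbertLetters (W₂ toL2 toL2S DL2 DstarL2 covLapSite)
open Summit.QuantumFields.YangMills.Theorems.Prop7LandauDict (DL2_toL2S_eq_covDerivFwdT DstarL2_toL2_eq_covDivFormT)
open Summit.QuantumFields.YangMills.Theorems.Prop7LaplaceAFlatLetters (norm_sq_toL2 norm_sq_toL2S)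
open Summit.QuantumFields.YangMills.Theorems.Prop7HessOnPrintSlice (norm_sq_dstar_le_of_bernstein_at inner_DstarL2_left)

/-! ## §1 Pullback dictionary for site functions and the divergence of a one-form -/

section Pullback

variable {P : Params} {s : ℕ} {𝔸 : Type*} [NormedRing 𝔸] [NormedAlgebra ℂ 𝔸]

/-- **DICTIONARY, `Δ^η_{U₀}` on SITE functions**: `covLap η V♯_y (G ∘ τ_y) z = Σ_μ (D^{η*}_{V,μ} D^η_{V,μ} G)(y + z)`.
[cite: Balaban1985BackgroundPropagators, (3.23) p.394; Balaban1985RegularSpaces, (1.1) p.76] -/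
theorem covLap_pull_site (η : ℝ) (V : GaugeField P s 𝔸ˣ) (G : Site P s → 𝔸) (y : Site P s) (z : LSite P.d) :
    covLap η (pull V y) (fun z' => G (transl y z')) z = ∑ μ : Fin P.d, covDerivT η V μ (covDerivFwdT η V μ G) (transl y z) := by
  have h : ∀ μ : Fin P.d, (fun z' => covDerivFwd η (pull V y) μ (fun z'' => G (transl y z'')) z') = fun z' => covDerivFwdT η V μ G (transl y z') :=
    fun μ => funext fun z' => covDerivFwd_pull η V y μ G z'
  unfold covLap covDivB
  refine Finset.sum_congr rfl fun μ _ => ?_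
  rw [h μ, covDeriv_pull]

/-! ## §3 Real scalings of the torus one-form calculus -/

/-- `D^η_{V,μ}(c•G) = c•D^η_{V,μ}G` for a real scalar. [cite: Balaban1985RegularSpaces, (1.1) p.76] -/
theorem covDerivFwdT_smul_real (η c : ℝ) (V : GaugeField P s 𝔸ˣ) (μ : Fin P.d) (G : Site P s → 𝔸) (x : Site P s) :
    covDerivFwdT η V μ (fun z => c • G z) x = c • covDerivFwdT η V μ G x := by
  unfold covDerivFwdT
  rw [conjR_smul_real, ← smul_sub, smul_comm]

/-- `D^{η*}_{V,μ}(c•G) = c•D^{η*}_{V,μ}G` for a real scalar. [cite: Balaban1985RegularSpaces, (1.1) p.76] -/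
theorem covDerivT_smul_real (η c : ℝ) (V : GaugeField P s 𝔸ˣ) (μ : Fin P.d) (G : Site P s → 𝔸) (x : Site P s) :
    covDerivT η V μ (fun z => c • G z) x = c • covDerivT η V μ G x := by
  unfold covDerivT
  rw [conjR_smul_real, ← smul_sub, smul_comm]

/-- `D^{η*}_V(c•X) = c•D^{η*}_V X` for a real scalar. [cite: Balaban1985RegularSpaces, (1.2) p.76] -/
theorem covDivFormT_smul_real (η c : ℝ) (V : GaugeField P s 𝔸ˣ) (X : PBond P s → 𝔸) (x : Site P s) :
    covDivFormT η V (fun b => c • X b) x = c • covDivFormT η V X x := by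
  unfold covDivFormT
  rw [Finset.smul_sum]
  refine Finset.sum_congr rfl fun μ _ => ?_
  exact covDerivT_smul_real η c V μ (formComp X μ) x

end Pullback

/-! ## §2 `IsLandauPrint` in torus letters -/

variable (F : T3Family) (n K : ℕ) (c₀ : ℝ)

/-- ★ **THE PROJECTED LANDAU GAUGE (1.38) READ ON THE TORUS**: `IsLandauPrint F n K U₀ X` (lit `IsLandau138` on the based periodic pullbacks, top level) says: there is a
multiplier `μ` with `Σ_κ (D^{η*}_κ D^η_κ (D^{η*}_{U₀}(η⁻¹X)))(basePt + z) = (Q′ᵀμ)(z)` for every `z ∈ ℤ³`. [cite: Balaban1985RegularSpaces, (1.38) p.82; Balaban1985Variational, (21) p.281] -/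
theorem isLandauPrint_torus {U₀ : GaugeField (F.P K) 0 (Matrix.specialUnitaryGroup (Fin 2) ℂ)} {X : PBond (F.P K) 0 → Matrix (Fin 2) (Fin 2) ℂ}
    (hX : IsLandauPrint F n K U₀ X) :
    ∃ μ : ℕ → LSite (F.P K).d → Matrix (Fin 2) (Fin 2) ℂ, ∀ z : LSite (F.P K).d,
      ∑ κ : Fin (F.P K).d, covDerivT (eta F n K) (bgUnits F K U₀) κ
          (covDerivFwdT (eta F n K) (bgUnits F K U₀) κ (covDivFormT (eta F n K) (bgUnits F K U₀) (fun b => (eta F n K)⁻¹ • X b))) (transl (basePt F n K) z)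
        = QT (F.P K).L (K - n) (torusLam (K - n)) (pull (bgUnits F K U₀) (basePt F n K)) μ z := by
  obtain ⟨μ, hμ⟩ := hX
  refine ⟨μ, fun z => ?_⟩
  have h := hμ z (Set.mem_univ z)
  rw [Set.indicator_univ] at h
  have hdiv : covDivB (eta F n K) (pull (unitsField (toUField U₀)) (basePt F n K)) (pull (fun b => (eta F n K)⁻¹ • X b) (basePt F n K))
      = fun z' => covDivFormT (eta F n K) (bgUnits F K U₀) (fun b => (eta F n K)⁻¹ • X b) (transl (basePt F n K) z') :=
    funext fun z' => Prop7LandauCombDict.covDivB_pull _ _ _ _ z'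
  rw [hdiv, covLap_pull_site] at h
  exact h

/-! ## §4 The member's norms and letters on functions -/

variable [Fact (0 < c₀)]

/-- ★★ **`‖D_{U₀}(toL2S f)‖² = c₀·Σ_b Σ_{jk} |(D^η_{U₀} f)(b)_{jk}|²`** (✓ `DL2_toL2S_eq_covDerivFwdT` + ✓ `norm_sq_toL2`). [cite: Balaban1985BackgroundPropagators, (3.3) p.391, (3.11) p.392] -/
theorem norm_sq_DL2_toL2S (U₀ : GaugeField (F.P K) 0 (Matrix.specialUnitaryGroup (Fin 2) ℂ)) (f : Site (F.P K) 0 → Matrix (Fin 2) (Fin 2) ℂ) :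
    ‖DL2 F n K c₀ U₀ (toL2S F K c₀ f)‖ ^ 2
      = c₀ * ∑ b : PBond (F.P K) 0, ∑ j : Fin 2, ∑ k : Fin 2, ‖(covDerivFwdT (eta F n K) (bgUnits F K U₀) b.dir f b.src) j k‖ ^ 2 := by
  have hfun : DL2 F n K c₀ U₀ (toL2S F K c₀ f) = toL2 F K c₀ (fun b => covDerivFwdT (eta F n K) (bgUnits F K U₀) b.dir f b.src) := by
    apply (toL2 F K c₀).symm.injective
    rw [LinearEquiv.symm_apply_apply]
    funext b
    exact DL2_toL2S_eq_covDerivFwdT (F := F) (n := n) (K := K) (c₀ := c₀) U₀ f b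
  rw [hfun, norm_sq_toL2]

/-! ## §5 ★★★ The crude slice at a curved background from the comb Bernstein row -/

/-- ★★★ **THE CRUDE SLICE ON PRINT'S SLICE AT THE BACKGROUND `U₀`, FROM THE COMB BERNSTEIN ROW** (the P-A4 member reading).  HYPOTHESIS `hF1` = the comb Bernstein row at `U₀`
in torus letters (px19 g5's F1-inst conclusion, DISPLAYED): every gauge parameter `f` whose covariant site Laplacian is, on the based pullback, a comb-average transpose
`Q′_{K−n}(U₀)ᵀμ` (lit `QT … (torusLam (K−n))`, top level) has `Σ_b Σ_{jk}|(D^η_{U₀}f)(b)_{jk}|² ≤ C·Σ_x Σ_{jk}|f(x)_{jk}|²`.  CONCLUSION: for every route field `X` in print's projected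
Landau gauge `IsLandauPrint F n K U₀ X`, `‖D*_{U₀}X̃‖² ≤ C·‖X̃‖²` (`X̃ = toL2 X`) — the divergence budget `DIV ≤ δ₁ℓ⁻²M` with `ζ = 0`, `δ₁ = C`.  Proof: §2 gives the slice hypothesis at
`f₀ := D^{η*}_{U₀}(η⁻¹X) = η⁻¹•D^{η*}_{U₀}X` (§3), `hF1` at `f₀`, the real scaling `η⁻²` cancels (§3), §4 reads both sides as `‖D_{U₀}(D*_{U₀}X̃)‖² ≤ C‖D*_{U₀}X̃‖²`, and ✓
`norm_sq_dstar_le_of_bernstein_at` closes. [cite: Balaban1985Variational, (21) p.281, Prop. 7 p.299; Balaban1985BackgroundPropagators, (3.8) p.392, (3.21)–(3.23) p.394, (3.42) p.398; Balaban1985RegularSpaces, (1.38) p.82] -/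
theorem div_sq_le_of_combBernsteinRow (U₀ : GaugeField (F.P K) 0 (Matrix.specialUnitaryGroup (Fin 2) ℂ)) {C : ℝ} (hC : 0 ≤ C)
    (hF1 : ∀ f : Site (F.P K) 0 → Matrix (Fin 2) (Fin 2) ℂ,
      (∃ μ : ℕ → LSite (F.P K).d → Matrix (Fin 2) (Fin 2) ℂ, ∀ z : LSite (F.P K).d,
        ∑ κ : Fin (F.P K).d, covDerivT (eta F n K) (bgUnits F K U₀) κ (covDerivFwdT (eta F n K) (bgUnits F K U₀) κ f) (transl (basePt F n K) z)
          = QT (F.P K).L (K - n) (torusLam (K - n)) (pull (bgUnits F K U₀) (basePt F n K)) μ z) →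
      ∑ b : PBond (F.P K) 0, ∑ j : Fin 2, ∑ k : Fin 2, ‖(covDerivFwdT (eta F n K) (bgUnits F K U₀) b.dir f b.src) j k‖ ^ 2
        ≤ C * ∑ x : Site (F.P K) 0, ∑ j : Fin 2, ∑ k : Fin 2, ‖f x j k‖ ^ 2)
    (X : PBond (F.P K) 0 → Matrix (Fin 2) (Fin 2) ℂ) (hX : IsLandauPrint F n K U₀ X) :
    ‖DstarL2 F n K c₀ U₀ (toL2 F K c₀ X)‖ ^ 2 ≤ C * ‖toL2 F K c₀ X‖ ^ 2 := by
  -- letters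
  set η : ℝ := eta F n K with hηdef
  set V := bgUnits F K U₀ with hV
  have hη0 : 0 < η := eta_pos F n K
  set f₁ : Site (F.P K) 0 → Matrix (Fin 2) (Fin 2) ℂ := fun x => covDivFormT η V X x with hf₁
  set f₀ : Site (F.P K) 0 → Matrix (Fin 2) (Fin 2) ℂ := fun x => covDivFormT η V (fun b => η⁻¹ • X b) x with hf₀
  have hf₀₁ : f₀ = fun x => η⁻¹ • f₁ x := by
    funext x
    rw [hf₀, hf₁]
    exact covDivFormT_smul_real η η⁻¹ V X x
  -- the slice hypothesis at `f₀`, then the Bernstein row at `f₀`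
  have hslice := isLandauPrint_torus F n K hX
  have hrow := hF1 f₀ hslice
  -- remove the scaling `η⁻¹`
  have hL : ∑ b : PBond (F.P K) 0, ∑ j : Fin 2, ∑ k : Fin 2, ‖(covDerivFwdT η V b.dir f₀ b.src) j k‖ ^ 2
      = η⁻¹ ^ 2 * ∑ b : PBond (F.P K) 0, ∑ j : Fin 2, ∑ k : Fin 2, ‖(covDerivFwdT η V b.dir f₁ b.src) j k‖ ^ 2 := by
    rw [Finset.mul_sum]
    refine Finset.sum_congr rfl fun b _ => ?_
    rw [hf₀₁, covDerivFwdT_smul_real, Finset.mul_sum]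
    refine Finset.sum_congr rfl fun j _ => ?_
    rw [Finset.mul_sum]
    refine Finset.sum_congr rfl fun k _ => ?_
    rw [Matrix.smul_apply, norm_smul, mul_pow, Real.norm_eq_abs, sq_abs]
  have hR : ∑ x : Site (F.P K) 0, ∑ j : Fin 2, ∑ k : Fin 2, ‖f₀ x j k‖ ^ 2 = η⁻¹ ^ 2 * ∑ x : Site (F.P K) 0, ∑ j : Fin 2, ∑ k : Fin 2, ‖f₁ x j k‖ ^ 2 := by
    rw [Finset.mul_sum]
    refine Finset.sum_congr rfl fun x _ => ?_
    rw [hf₀₁, Finset.mul_sum]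
    refine Finset.sum_congr rfl fun j _ => ?_
    rw [Finset.mul_sum]
    refine Finset.sum_congr rfl fun k _ => ?_
    dsimp only
    rw [Matrix.smul_apply, norm_smul, mul_pow, Real.norm_eq_abs, sq_abs]
  rw [hL, hR] at hrow
  have hη2 : 0 < η⁻¹ ^ 2 := by positivity
  have hrow' : ∑ b : PBond (F.P K) 0, ∑ j : Fin 2, ∑ k : Fin 2, ‖(covDerivFwdT η V b.dir f₁ b.src) j k‖ ^ 2
      ≤ C * ∑ x : Site (F.P K) 0, ∑ j : Fin 2, ∑ k : Fin 2, ‖f₁ x j k‖ ^ 2 := by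
    have := hrow
    rw [mul_left_comm] at this
    exact le_of_mul_le_mul_left this hη2
  -- read both sides in the member's `L²` letters
  have hc₀ : 0 ≤ c₀ := (Fact.out : 0 < c₀).le
  have hB : ‖DL2 F n K c₀ U₀ (DstarL2 F n K c₀ U₀ (toL2 F K c₀ X))‖ ^ 2 ≤ C * ‖DstarL2 F n K c₀ U₀ (toL2 F K c₀ X)‖ ^ 2 := by
    rw [Prop7LandauCombDict.DstarL2_toL2_eq (F := F) (n := n) (K := K) (c₀ := c₀) U₀ X, norm_sq_DL2_toL2S F n K c₀ U₀, norm_sq_toL2S]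
    have := mul_le_mul_of_nonneg_left hrow' hc₀
    calc c₀ * ∑ b : PBond (F.P K) 0, ∑ j : Fin 2, ∑ k : Fin 2, ‖(covDerivFwdT η V b.dir f₁ b.src) j k‖ ^ 2
        ≤ c₀ * (C * ∑ x : Site (F.P K) 0, ∑ j : Fin 2, ∑ k : Fin 2, ‖f₁ x j k‖ ^ 2) := this
      _ = C * (c₀ * ∑ x : Site (F.P K) 0, ∑ i : Fin 2, ∑ i' : Fin 2, ‖f₁ x i i'‖ ^ 2) := by ring
  exact norm_sq_dstar_le_of_bernstein_at (DL2 F n K c₀ U₀) (DstarL2 F n K c₀ U₀) (inner_DstarL2_left F n K c₀ U₀) hC (toL2 F K c₀ X) hB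


/-! ## §6 ★★★ The crude slice at a curved background from the COMPETITOR ROW (energy comparison folded in, via ★w1-19200 g14's Landau–comb dictionary) -/

omit [Fact (0 < c₀)] in
/-- `toL2 (c • X) = (c : ℂ) • toL2 X` for a real scalar. [folklore] -/
theorem toL2_smul_real (c : ℝ) (X : PBond (F.P K) 0 → Matrix (Fin 2) (Fin 2) ℂ) :
    toL2 F K c₀ (fun b => c • X b) = ((c : ℝ) : ℂ) • toL2 F K c₀ X := by
  have hcX : (fun b => c • X b) = ((c : ℝ) : ℂ) • X := by
    funext b
    exact RCLike.real_smul_eq_coe_smul (K := ℂ) c (X b)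
  rw [hcX, LinearEquiv.map_smul]

/-- ★★★ **THE CRUDE SLICE ON PRINT'S SLICE AT `W ∈ RegPr`, FROM THE COMPETITOR ROW** (P-A4 = V1 + F1 + F2 + F3 assembled at the door; (a) «energy comparison» folded in).
HYPOTHESES: `RegPr F n K a W` with the two windows of ✓ `Prop7LandauCombDict.bgT_pull_mem_unitaryUnits_of_regPr` (unitary comb transports), `IsLandauPrint F n K W X`, and the
DISPLAYED COMPETITOR ROW `hcomp` (px19 g5's F1-inst∕(b) conclusion VERBATIM): every gauge parameter `f` admits a competitor `fC` in its residual comb class (`Q′_{K−n}(W)((fC − f)♯) = 0`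
on the based pullback) with `Σ_bΣ_jk|(D^η_W fC)(b)_jk|² ≤ C·Σ_xΣ_jk|f(x)_jk|²`.  CONCLUSION: `‖D*_W X̃‖² ≤ C·‖X̃‖²`.  PROOF: at `f := D^{η*}_W X` (= `(toL2S)⁻¹(D*_W X̃)`, ✓
`Prop7LandauCombDict.DstarL2_toL2_eq`) the competitor's class condition and ✓ `Prop7LandauCombDict.inner_covLapSite_DstarL2_eq_zero_of_isLandau138` give `⟪Δ^η_W(f̃C − f̃), f̃⟫ = 0`, i.e.
`⟪D_W(f̃C − f̃), D_W f̃⟫ = 0` (✓ `inner_DstarL2_left`), so by Pythagoras `‖D_W f̃‖² ≤ ‖D_W f̃C‖² = c₀·Σ|D^η fC|² ≤ c₀C·Σ|f|² = C‖f̃‖²`; ✓ `norm_sq_dstar_le_of_bernstein_at` closes.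
[cite: Balaban1985Variational, (21) p.281, Prop. 7 p.299; Balaban1985BackgroundPropagators, (3.8) p.392, (3.19)–(3.23) pp.393–394, (3.42) p.398; Balaban1985RegularSpaces, (1.38) p.82] -/
theorem div_sq_le_of_competitorRow {a : ℝ} (ha : 0 < a) (hα3 : B7Prop2Explicit.C0 (F.P K).d * (2 * a) ≤ 1 / 3)
    (hα4 : 4 * a ≤ B7Prop2Explicit.c2' (F.P K).d (F.P K).L)
    {W : GaugeField (F.P K) 0 (Matrix.specialUnitaryGroup (Fin 2) ℂ)} (hreg : T3PrintedRegularMinimiser.RegPr F n K a W) {C : ℝ} (hC : 0 ≤ C)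
    (hcomp : ∀ f : Site (F.P K) 0 → Matrix (Fin 2) (Fin 2) ℂ, ∃ fC : Site (F.P K) 0 → Matrix (Fin 2) (Fin 2) ℂ,
      (∀ y : LSite (F.P K).d,
        B7Eq78Linearization.QprimeIter (B7Eq78Linearization.zdBlocking (F.P K).d (F.P K).L)
          (B8Eq119TwistedAxial.bgT (F.P K).L (pull (bgUnits F K W) (basePt F n K))) (K - n)
          (fun z => (fC - f) (transl (basePt F n K) z)) y = 0) ∧
      ∑ b : PBond (F.P K) 0, ∑ j : Fin 2, ∑ k : Fin 2, ‖(covDerivFwdT (eta F n K) (bgUnits F K W) b.dir fC b.src) j k‖ ^ 2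
        ≤ C * ∑ x : Site (F.P K) 0, ∑ j : Fin 2, ∑ k : Fin 2, ‖f x j k‖ ^ 2)
    (X : PBond (F.P K) 0 → Matrix (Fin 2) (Fin 2) ℂ) (hX : IsLandauPrint F n K W X) :
    ‖DstarL2 F n K c₀ W (toL2 F K c₀ X)‖ ^ 2 ≤ C * ‖toL2 F K c₀ X‖ ^ 2 := by
  set η : ℝ := eta F n K with hηdef
  have hη0 : 0 < η := eta_pos F n K
  -- the divergence on functions and its competitor
  set f : Site (F.P K) 0 → Matrix (Fin 2) (Fin 2) ℂ := fun x => covDivFormT η (bgUnits F K W) X x with hf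
  have hDf : DstarL2 F n K c₀ W (toL2 F K c₀ X) = toL2S F K c₀ f := Prop7LandauCombDict.DstarL2_toL2_eq (F := F) (n := n) (K := K) (c₀ := c₀) W X
  obtain ⟨fC, hQ, hE⟩ := hcomp f
  -- orthogonality `⟪Δ(l̃), D*X̃⟫ = 0` for `l = fC − f` (w1's dictionary; `IsLandauPrint` is `IsLandau138` at `A := η⁻¹•X`)
  have hT := Prop7LandauCombDict.bgT_pull_mem_unitaryUnits_of_regPr F (n := n) (K := K) ha hα3 hα4 hreg
  have h0 : ⟪covLapSite F n K c₀ W (toL2S F K c₀ (fC - f)), DstarL2 F n K c₀ W (toL2 F K c₀ (fun b => η⁻¹ • X b))⟫_ℂ = 0 :=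
    Prop7LandauCombDict.inner_covLapSite_DstarL2_eq_zero_of_isLandau138 (c₀ := c₀) W (fun b => η⁻¹ • X b) hX hT (fC - f) hQ
  have horth : ⟪covLapSite F n K c₀ W (toL2S F K c₀ (fC - f)), DstarL2 F n K c₀ W (toL2 F K c₀ X)⟫_ℂ = 0 := by
    rw [toL2_smul_real, map_smul, inner_smul_right, mul_eq_zero] at h0
    rcases h0 with h0 | h0
    · exfalso
      have : ((η⁻¹ : ℝ) : ℂ) ≠ 0 := by exact_mod_cast (inv_ne_zero hη0.ne')
      exact this h0
    · exact h0
  -- `⟪D l̃, D f̃⟫ = 0`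
  have hDD : ⟪DL2 F n K c₀ W (toL2S F K c₀ (fC - f)), DL2 F n K c₀ W (toL2S F K c₀ f)⟫_ℂ = 0 := by
    rw [← hDf, ← inner_DstarL2_left F n K c₀ W]
    simpa only [covLapSite, LinearMap.comp_apply] using horth
  -- Pythagoras: `‖D f̃‖² ≤ ‖D(f̃ + l̃)‖² = ‖D f̃C‖²`
  have hsplit : toL2S F K c₀ fC = toL2S F K c₀ f + toL2S F K c₀ (fC - f) := by
    rw [← map_add]; congr 1; abel
  have hpy : ‖DL2 F n K c₀ W (toL2S F K c₀ fC)‖ ^ 2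
      = ‖DL2 F n K c₀ W (toL2S F K c₀ f)‖ ^ 2 + ‖DL2 F n K c₀ W (toL2S F K c₀ (fC - f))‖ ^ 2 := by
    rw [hsplit, map_add]
    have h := @norm_add_sq ℂ _ _ _ _ (DL2 F n K c₀ W (toL2S F K c₀ f)) (DL2 F n K c₀ W (toL2S F K c₀ (fC - f)))
    have hre : RCLike.re ⟪DL2 F n K c₀ W (toL2S F K c₀ f), DL2 F n K c₀ W (toL2S F K c₀ (fC - f))⟫_ℂ = 0 := by
      rw [← inner_conj_symm, hDD, map_zero, RCLike.zero_re]
    rw [h, hre, mul_zero, add_zero]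
  have hle : ‖DL2 F n K c₀ W (toL2S F K c₀ f)‖ ^ 2 ≤ ‖DL2 F n K c₀ W (toL2S F K c₀ fC)‖ ^ 2 := by
    rw [hpy]; exact le_add_of_nonneg_right (sq_nonneg _)
  -- norms on functions
  have hc₀ : 0 ≤ c₀ := (Fact.out : 0 < c₀).le
  have hB : ‖DL2 F n K c₀ W (DstarL2 F n K c₀ W (toL2 F K c₀ X))‖ ^ 2 ≤ C * ‖DstarL2 F n K c₀ W (toL2 F K c₀ X)‖ ^ 2 := by
    rw [hDf]
    refine hle.trans ?_
    rw [norm_sq_DL2_toL2S F n K c₀ W, norm_sq_toL2S]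
    have := mul_le_mul_of_nonneg_left hE hc₀
    calc c₀ * ∑ b : PBond (F.P K) 0, ∑ j : Fin 2, ∑ k : Fin 2, ‖(covDerivFwdT η (bgUnits F K W) b.dir fC b.src) j k‖ ^ 2
        ≤ c₀ * (C * ∑ x : Site (F.P K) 0, ∑ j : Fin 2, ∑ k : Fin 2, ‖f x j k‖ ^ 2) := this
      _ = C * (c₀ * ∑ x : Site (F.P K) 0, ∑ i : Fin 2, ∑ i' : Fin 2, ‖f x i i'‖ ^ 2) := by ring
  exact norm_sq_dstar_le_of_bernstein_at (DL2 F n K c₀ W) (DstarL2 F n K c₀ W) (inner_DstarL2_left F n K c₀ W) hC (toL2 F K c₀ X) hB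

end Summit.QuantumFields.YangMills.Theorems.Prop7DivSqOfCombBernsteinRow

end
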